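import Summits.HodgeConjecture.HodgeConjecture.Theses.PadicSemiregularLift
import Summits.HodgeConjecture.HodgeConjecture.Theorems.PadicSemiregularLiftHodgeBeyondAnchorsMotivatedSplit
import Summits.HodgeConjecture.HodgeConjecture.Theorems.PadicSemiregularLiftHodgeBeyondAnchorsDiagonalPullback
import Summits.HodgeConjecture.HodgeConjecture.Theorems.PadicSemiregularLiftHodgeBeyondAnchorsSupportedClassNeZero
import Summits.HodgeConjecture.HodgeConjecture.Theorems.PadicSemiregularLiftHodgeBeyondAnchorsThomLineTransport
import Summits.HodgeConjecture.HodgeConjecture.Theorems.HodgeBeyondAnchors.Negative.FalseWithoutIsSmoothProjective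
import Literature.AlgebraicGeometry.HodgeTheory.MovingLemmaExcessInduction
import Literature.AlgebraicGeometry.HodgeTheory.AmbientClassesMoving
import Literature.AlgebraicGeometry.HodgeTheory.SupportedClassesPurity
import Literature.AlgebraicGeometry.HodgeTheory.GysinFormalismCorrespondences
import Literature.AlgebraicGeometry.Motives.FiniteMorphismCodimension
import Literature.AlgebraicGeometry.Motives.VarietiesProjectiveSpaceProofs
import Literature.AlgebraicGeometry.Motives.ComplexPointsEtaleLocalHomeomorph
import Literature.AlgebraicGeometry.Motives.ComplexPointsEhresmann
import Literature.AlgebraicTopology.SingularHomology.LocallyFlatPairMapBox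
import Literature.AlgebraicTopology.SingularHomology.KroneckerPairingLocality
import Literature.NumberTheory.Transcendental.AnalytificationClosure
import Literature.NumberTheory.Transcendental.AnalytificationConnectedOpen

/-!
# Line `andre-motivated-split` for crux `HodgeBeyondAnchors` (stmt-HodgeConjecture-14054) — skeleton v3 (lead c2, 2026-08-17)

Crux-strategist line (planner-cstrat-stmt-HodgeConjecture-14054-p1-0), route `PadicSemiregularLift`;
leads c1 (2026-08-17T01:54Z–02:25Z) and c2 (this file). The crux is kernel-checked EQUIVALENT to the
summit (`Theorems/…HodgeBeyondAnchorsUnconditional.lean: hodgeBeyondAnchors_iff_hodgeConjecture_holds`),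
so a line for it is a line for the Hodge conjecture; this line splits the PROPERTY "algebraic" along
André's chain `algebraic ⊆ motivated ⊆ Hodge` (Y. André, Publ. IHÉS 83 (1996) §0.3, Déf. 1, Thm 0.4):

* `stub_hodgeClassesMotivated` — (HM) rational `(p,p)`-classes in the deep middle are MOTIVATED.
  CONJECTURE-GRADE; verbatim the crux item `MotivatedLefschetzSplit.HodgeClassesMotivated`
  (stmt-HodgeConjecture-17488). Not worked by this line (other route's crux).
* `stub_lefschetzStandardB` — (B) Grothendieck's standard conjecture of Lefschetz type (André's
  `*_L`-form). CONJECTURE-GRADE; verbatim the crux item `MotivatedLefschetzSplit.LefschetzStandardB`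
  (stmt-HodgeConjecture-17489). Not worked by this line.
* (Δ) — lead c1 landed the range `p ≤ 1 ∨ d ≤ p + 1` (p138172) and showed (p137440) that on the
  coniveau carrier (Δ) ⟺ `Voisin2003_cupProduct_algebraicClasses` (`Nˡ H²ˡ ∪ Nᵏ H²ᵏ ⊆ Nˡ⁺ᵏ`), which
  the tree reduces (everything proved) to the CONE STEP `hstep` of Chow's moving lemma
  (`Literature/…/MovingLemmaExcessInduction.lean`, `cupProduct_mem_algebraicClasses_of_coneStep`).
  This skeleton proves `hstep` itself (theorem `coneStep`, sorry-free glue) from the remaining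
  theorem-grade stubs and LANDED theorems:
  - `stub_genericProjection` (Π, ALGEBRAIC GEOMETRY — Fulton *Intersection Theory* §11.4
    Ex. 11.4.1 (a)–(b), proved in J. Roberts, *Chow's moving lemma*, Oslo 1970 (1972) Main Lemma):
    when `Z` meets `W` IMPROPERLY there are a finite `φ : X ⟶ ℙⁿ` and a closed `Z' ⊉ Z` of
    codimension `≥ l` with `φ⁻¹(φ Z) ⊆ Z ∪ Z'`, `codim (Z' ∩ W) > codim (Z ∩ W)` (Ex. 11.4.1 (b)), and
    `φ` smooth (= étale, `φ` being finite) on an open set meeting `Z` (Ex. 11.4.1 (a): `X · C_L` is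
    generically transversal along `Z`). v3 RESHAPE: the properness split is done in the glue, the
    unramifiedness clause is stated with Mathlib's `AlgebraicGeometry.Smooth` on an open subscheme
    (print-faithful), and only ONE good complex point is consumed (Θ below). This statement is filed
    verbatim as the Literature named fact `Roberts1972_genericProjection` (lead c2, cone-step file).
  - `stub_localHomeomorph_of_smooth` (E, GAGA — SGA1 XII Prop. 3.1 (iii)): `φ(ℂ)` is a local
    homeomorphism at the complex points of an open `U ⊆ X` with `φ|_U` smooth; the tree has the case
    `U = X` (`ComplexPoints.exists_openPartialHomeomorph_eqOn_map`), this is its transport along the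
    open embedding `U(ℂ) ↪ X(ℂ)` (`AlgPoints.isOpenEmbedding_map_holds`). THEOREM-GRADE, S.
  - `stub_coneTransport` (Θ, TOPOLOGY): transport of the Thom line along the finite `φ` at ONE good
    complex point — PROVED by lead c2 (sorry-free `lemmas/ConeTransport.lean`, proposed under
    `Theorems/…ConeTransport.lean`); a registered stub only until that file lands, then imported.
  LANDED and imported: (A) `stub_supportedClass_ne_zero` (p140150, an irreducible `C ⊆ Y` of
  codimension `l` supports a non-zero class of `H²ˡ(Y(ℂ); ℂ)`), (T) `stub_thomLineTransport`
  (p140530, the topological Thom-line transport); PROVED here (glue): `exists_goodPoint`, `coneStep`,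
  `cupProduct_algebraicClasses : Voisin2003_cupProduct_algebraicClasses`, `HodgeBeyondAnchors_of`.
  The `T`-part of the cone step is the tree's `map_projectiveSpace_mem_iSup_ker_restrictCompl`
  (`AmbientClassesMoving`), the codimension book-keeping of finite morphisms is
  `Motives/FiniteMorphismCodimension`, the degenerate cases are semipurity
  (`injective_restrictCompl_of_le_coheight`).

Composition (all kernel-checked below, sorries only in `stub_*`): `coneStep` ⟹
`cupProduct_algebraicClasses : Voisin2003_cupProduct_algebraicClasses` ⟹ `HodgeBeyondAnchors_of`
through the LANDED glue `hodgeBeyondAnchors_of_motivated_of_standardConjectureB_of_cupProduct`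
(p137440). By p137440/p138172 the same `cupProduct_algebraicClasses` also yields (Δ) verbatim
(`diagonalPullbackAlgebraic_iff_cupProduct`), the support item stmt-HodgeConjecture-17490, and the
named facts `fulton1998_map_mem_algebraicClasses` / `Voisin2003_cupProduct_algebraicClasses`.

Disproof.lean honoured: `hodgeBeyondAnchors_false_without_isSmoothProjective` /
`…_false_with_decoupled_index` (Negative/FalseWithoutIsSmoothProjective, p99636) — every stub keeps
`IsSmoothProjective` of its varieties with one index; no `-- Targets` entry concerns these stubs.
-/

set_option linter.dupNamespace false

noncomputable section

open CategoryTheory AlgebraicGeometry MonoidalCategory CartesianMonoidalCategory Order Set TopologicalSpace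
open Literature.AlgebraicTopology.SingularHomology Literature.Geometry.Kaehler
open Literature.AlgebraicGeometry.Motives Literature.AlgebraicGeometry.HodgeTheory

namespace Summit.HodgeConjecture.HodgeConjecture.Cruxes.HodgeBeyondAnchors.AndreMotivatedSplit

open Summit.HodgeConjecture.HodgeConjecture.Theses.PadicSemiregularLift
open Summit.HodgeConjecture.HodgeConjecture.Theorems.HodgeBeyondAnchors

/-! ## Registered stubs -/

/-- **(HM) Hodge classes in the deep middle are motivated** (André 1996, Déf. 1 / question after
Thm 0.6.2; Arapura 2006 p. 762 "a weak form of the Hodge conjecture"). For `X` smooth projective of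
dimension `n` over `ℂ`, `2 ≤ p`, `2p ≤ n`, every rational class of Hodge type `(p,p)` in
`H²ᵖ(X(ℂ); ℂ)` lies in `A_motᵖ(X)_ℂ = motivatedClasses n X p`. CONJECTURE-GRADE; verbatim the crux item
`MotivatedLefschetzSplit.HodgeClassesMotivated` (stmt-HodgeConjecture-17488). Known: abelian varieties
(Thm 0.6.2), varieties motivated by them (K3, cubic hypersurfaces: Thm 0.6.3; Fermat hypersurfaces via
Shioda–Katsura), Lefschetz range (tree: `mem_motivatedClasses_of_lefschetzRange`). -/
theorem stub_hodgeClassesMotivated :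
    ∀ ⦃n : ℕ⦄ ⦃X : SchemeOver ℂ⦄, IsSmoothProjective n X →
      ∀ p : ℕ, 2 ≤ p → 2 * p ≤ n →
        ∀ c : complexBetti X (2 * p), IsRationalClass c → IsOfHodgeType n X (2 * p) p p c →
          c ∈ motivatedClasses n X p := by
  sorry

/-- **(B) The standard conjecture of Lefschetz type, André's `*_L`-form, for every smooth projective
complex variety** (Grothendieck 1968 §3; André 1996 §0.2–0.3, Prop. 1.2). CONJECTURE-GRADE; verbatim
the crux item `MotivatedLefschetzSplit.LefschetzStandardB` (stmt-HodgeConjecture-17489). Known: curves,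
surfaces, abelian varieties (Lieberman 1968), flag varieties, complete intersections, varieties
motivated by surfaces (Arapura 2006), hyperkähler of K3^[n] type (Charles–Markman 2013); in-tree:
the middle degree `a = b = d` for all `Z` and `d = 0` (worker audit, evidence on 17489). -/
theorem stub_lefschetzStandardB :
    ∀ (d : ℕ) (Z : SchemeOver ℂ) (η : complexBetti Z 2), IsSmoothProjective d Z →
      StandardConjectureBStar d Z η := by
  sorry

/-- **(Π) The generic projection cone of Chow's moving lemma** (Fulton, *Intersection Theory* §11.4
Example 11.4.1 (a)–(b), for the linear projection `π_L : X → ℙⁿ` from a generic centre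
`L ≅ ℙ^{m−n−1}` of an embedding `X ⊆ ℙᵐ`; proofs: J. Roberts, *Chow's moving lemma* (1972), Main
Lemma and Lemma 3; also Voisin II §9.2.4 Lemma 9.22). Let `X` be smooth projective of dimension `n`
over `ℂ`, `Z ⊆ X` irreducible closed of codimension exactly `l ≥ 1` (`V` in Fulton), `W ⊆ X`
irreducible closed of codimension `≥ k`, meeting IMPROPERLY: some point of `Z ∩ W` has codimension
`< l + k` (Fulton's `e > 0`), and let `s` bound the codimension of `Z ∩ W` from below. Then there are
a FINITE morphism `φ : X ⟶ ℙⁿ` (in print `π_L`, finite as `L ∩ X = ∅`) and a closed `Z' ⊆ X` (in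
print the support of the residual cycle `γ_L`, `π_L^*[C_L] = [Z] + γ_L`, i.e. the union of the
components of `φ⁻¹(φ Z) = X ∩ C_L(Z)` other than `Z`) such that: `Z ⊄ Z'` and `Z'` has codimension
`≥ l` (Ex. 11.4.1 (a): `C_L` meets `X` properly); `φ⁻¹(φ Z) ⊆ Z ∪ Z'`; every point of `Z' ∩ W` has
codimension `≥ s + 1` (Ex. 11.4.1 (b): `dim (Zᵢ' ∩ W) < dim (Z ∩ W)`); and `φ` is smooth — étale,
`φ` being finite — on an open subscheme meeting `Z` (Ex. 11.4.1 (a): the intersection `X · C_L` is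
generically transversal along `Z`, i.e. `π_L` is unramified at the generic point of `Z`).
THEOREM-GRADE (known in print, XL to formalise: generic linear projections, Roberts' excess count);
filed verbatim as the Literature named fact `Roberts1972_genericProjection`.
[cite: Fulton1998, §11.4 Example 11.4.1 (a)–(b)] [cite: Roberts1972, Main Lemma; Lemma 3] -/
theorem stub_genericProjection :
    ∀ ⦃n : ℕ⦄ ⦃X : SchemeOver ℂ⦄, IsSmoothProjective n X → ∀ ⦃l k s : ℕ⦄, 1 ≤ l →
      ∀ ⦃Z W : Set X.left⦄, IsClosed Z → IsIrreducible Z → (∀ z ∈ Z, (l : ℕ∞) ≤ coheight z) →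
        (∃ z ∈ Z, coheight z ≤ (l : ℕ∞)) → IsClosed W → IsIrreducible W →
        (∀ w ∈ W, (k : ℕ∞) ≤ coheight w) → (∃ t ∈ Z ∩ W, coheight t < ((l + k : ℕ) : ℕ∞)) →
        (∀ t ∈ Z ∩ W, (s : ℕ∞) ≤ coheight t) →
        ∃ (φ : X ⟶ projectiveSpace n ℂ) (_ : IsFinite φ.left) (Z' : Set X.left),
          IsClosed Z' ∧ ¬ Z ⊆ Z' ∧ (∀ z ∈ Z', (l : ℕ∞) ≤ coheight z) ∧
          φ.left.base ⁻¹' (φ.left.base '' Z) ⊆ Z ∪ Z' ∧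
          (∀ t ∈ Z' ∩ W, ((s + 1 : ℕ) : ℕ∞) ≤ coheight t) ∧
          ∃ U : X.left.Opens, (∃ z ∈ Z, z ∈ U) ∧ Smooth (U.ι ≫ φ.left) := by
  sorry

/-- **(E) `φ(ℂ)` is a local homeomorphism at the complex points of an open subscheme on which `φ`
is smooth** (SGA1 XII Prop. 3.1 (iii): `f` étale ⇔ `f^an` a local isomorphism; Serre GAGA §2 n°5).
For `φ : X ⟶ Y` between smooth projective complex `n`-folds and an open `U ⊆ X` with `φ|_U` smooth
(hence étale), at every complex point `P` of `U` the map of complex points `φ(ℂ)` agrees near `P`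
with an open partial homeomorphism `X(ℂ) ⇀ Y(ℂ)`. Intended proof: the open subscheme
`openSubschemeOver X U` is smooth of relative dimension `n` and locally of finite type over `ℂ`, the
tree's `ComplexPoints.exists_openPartialHomeomorph_eqOn_map n` applies to `U ⟶ Y`, and the result is
transported along the open embedding `U(ℂ) ↪ X(ℂ)` (`AlgPoints.isOpenEmbedding_map_holds`,
`AlgPoints.range_map_of_isOpenImmersion_holds`, `AlgPoints.map_comp`). THEOREM-GRADE, S.
[cite: SGA1, Exp. XII Prop. 3.1 (iii)] -/
theorem stub_localHomeomorph_of_smooth :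
    ∀ ⦃n : ℕ⦄ ⦃X Y : SchemeOver ℂ⦄, IsSmoothProjective n X → IsSmoothProjective n Y →
      ∀ (φ : X ⟶ Y) (U : X.left.Opens), Smooth (U.ι ≫ φ.left) →
        ∀ P : ComplexPoints X, P.pt ∈ U →
          ∃ e : OpenPartialHomeomorph (ComplexPoints X) (ComplexPoints Y),
            P ∈ e.source ∧ Set.EqOn (AlgPoints.map φ) e e.source := by
  sorry

/-- **(Θ) Transport of the Thom line along a finite map at a point where it is a local homeomorphism**
("`Z` appears with multiplicity one in `φ⁻¹(φ Z)`": Voisin II §9.2.4 proof of Lemma 9.22; Fulton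
§19.1 eq. (3) `H²ˡ(X, X − V) ≅ H_{2n−2l}(V)` and Lemma 19.1.1; Hatcher §3.3 Lemma 3.27). For
`φ : X ⟶ Y` finite between smooth projective complex `n`-folds, `Z ⊆ X` irreducible closed of
codimension `≥ l ≥ 1`, `Z'` closed with `φ⁻¹(φ Z) ⊆ Z ∪ Z'`, and `φ(ℂ)` a local homeomorphism at
ONE complex point of `Z`: for every NON-ZERO `b ∈ H²ˡ(Y(ℂ); ℂ)` dying on `(Y ∖ φ Z)(ℂ)`, every class
dying on `(X ∖ Z)(ℂ)` is a multiple of `φ^* b` plus a class dying on `(X ∖ Z')(ℂ)`. PROVED by lead c2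
(sorry-free, `lemmas/ConeTransport.lean`, from the landed (T) `stub_thomLineTransport` p140530,
`GAGADimension.exists_closed_straightening_off`, `Motives/FiniteMorphismCodimension`, semipurity and
the SGA1 XII 2.2 density lemma `exists_mem_pt_mem_pt_not_mem`); kept as a registered stub only until
that helper file has landed under `Theorems/`, then replaced by the import.
[cite: VoisinHodgeII2003, §9.2.4 proof of Lemma 9.22] [cite: Fulton1998, §19.1 Lemma 19.1.1] -/
theorem stub_coneTransport :
    ∀ ⦃n : ℕ⦄ ⦃X Y : SchemeOver ℂ⦄, IsSmoothProjective n X → IsSmoothProjective n Y →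
      ∀ (φ : X ⟶ Y) [IsFinite φ.left] ⦃l : ℕ⦄, 1 ≤ l →
      ∀ ⦃Z Z' : Set X.left⦄, IsClosed Z → IsIrreducible Z → (∀ z ∈ Z, (l : ℕ∞) ≤ coheight z) →
        IsClosed Z' → φ.left.base ⁻¹' (φ.left.base '' Z) ⊆ Z ∪ Z' →
        (∃ P : ComplexPoints X, P.pt ∈ Z ∧
          ∃ e : OpenPartialHomeomorph (ComplexPoints X) (ComplexPoints Y),
            P ∈ e.source ∧ Set.EqOn (AlgPoints.map φ) e e.source) →
        ∀ ⦃b : complexBetti Y (2 * l)⦄,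
          complexBetti.restrictCompl Y (φ.left.base '' Z) (2 * l) b = 0 → b ≠ 0 →
          LinearMap.ker (complexBetti.restrictCompl X Z (2 * l)).hom ≤
            Submodule.span ℂ {complexBetti.map φ (2 * l) b} ⊔
              LinearMap.ker (complexBetti.restrictCompl X Z' (2 * l)).hom := by
  sorry

/-! ## Kernel-checked composition -/

/-- **A good complex point** (glue): from (Π)'s open `U` meeting the irreducible `Z` with `φ|_U`
smooth, a complex point `P` of `Z` at which `φ(ℂ)` is a local homeomorphism — complex points of the
non-empty `Z ∩ U` exist (`ComplexPoints.isConnected_setOf_pt_mem_inter_of_isIrreducible`, SGA1 XII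
2.4 / Nullstellensatz) and (E) applies there. [cite: SGA1, Exp. XII Prop. 3.1 (iii)] -/
theorem exists_goodPoint {n : ℕ} {X Y : SchemeOver ℂ} (hX : IsSmoothProjective n X)
    (hY : IsSmoothProjective n Y) (φ : X ⟶ Y) {Z : Set X.left} (hZ : IsClosed Z)
    (hZi : IsIrreducible Z) {U : X.left.Opens} (hZU : ∃ z ∈ Z, z ∈ U)
    (hU : Smooth (U.ι ≫ φ.left)) :
    ∃ P : ComplexPoints X, P.pt ∈ Z ∧
      ∃ e : OpenPartialHomeomorph (ComplexPoints X) (ComplexPoints Y),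
        P ∈ e.source ∧ Set.EqOn (AlgPoints.map φ) e e.source := by
  haveI := hX.smoothOfRelativeDimension
  haveI : LocallyOfFiniteType X.hom := by
    haveI : Smooth X.hom := SmoothOfRelativeDimension.smooth n _
    infer_instance
  obtain ⟨z, hz, hzU⟩ := hZU
  obtain ⟨P, hPZ, hPU⟩ :=
    (ComplexPoints.isConnected_setOf_pt_mem_inter_of_isIrreducible X hZ hZi U ⟨z, hz, hzU⟩).nonempty
  exact ⟨P, hPZ, stub_localHomeomorph_of_smooth hX hY φ U hU P hPU⟩

/-- **The cone step of Chow's moving lemma on the coniveau carrier** — verbatim the hypothesis `hstep`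
of `MovingLemmaExcessInduction.moving_of_coneStep` / `cupProduct_mem_algebraicClasses_of_coneStep` — from
(Π), (E), the landed (A), (T) and the tree: if `Z ∩ W` is already proper (codimension `≥ l + k`
pointwise) take `T := Z`; otherwise `l ≥ 1` (a point of `Z ∩ W ⊆ W` has codimension `≥ k`), and if no
point of `Z` has codimension `l` the kernel is `0` (semipurity); otherwise the generic projection `φ`
(Π), the non-zero class `b` supported on `φ(Z)` (closed irreducible of codimension `l`,
`image_codim_of_isFinite`; (A)), the transport `ker_Z ≤ ℂ φ^*b ⊔ ker_{Z'}` (Θ at a good point, (E)),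
and `φ^* b ∈ Σ_T ker_T` over closed `T` meeting `W` in codimension `≥ l + k`
(`map_projectiveSpace_mem_iSup_ker_restrictCompl`).
[cite: VoisinHodgeII2003, §9.2.4 Lemma 9.22] [cite: Fulton1998, §11.4 Ex. 11.4.1] [cite: Roberts1972, Main Lemma] -/
theorem coneStep {n : ℕ} {X : SchemeOver ℂ} (hX : IsSmoothProjective n X) {l k : ℕ} :
    ∀ ⦃Z W : Set X.left⦄, IsClosed Z → IsIrreducible Z →
      (∀ z ∈ Z, (l : ℕ∞) ≤ Order.coheight z) → IsClosed W → IsIrreducible W →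
      (∀ w ∈ W, (k : ℕ∞) ≤ Order.coheight w) → ∀ s : ℕ, s < l + k →
      (∀ t ∈ Z ∩ W, (s : ℕ∞) ≤ Order.coheight t) →
        LinearMap.ker (complexBetti.restrictCompl X Z (2 * l)).hom ≤
          (⨆ (T : Set X.left) (_ : IsClosed T)
            (_ : ∀ t ∈ T ∩ W, ((l + k : ℕ) : ℕ∞) ≤ Order.coheight t),
            LinearMap.ker (complexBetti.restrictCompl X T (2 * l)).hom) ⊔
          ⨆ (Z' : Set X.left) (_ : IsClosed Z') (_ : ∀ z ∈ Z', (l : ℕ∞) ≤ Order.coheight z)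
            (_ : ∀ t ∈ Z' ∩ W, ((s + 1 : ℕ) : ℕ∞) ≤ Order.coheight t),
            LinearMap.ker (complexBetti.restrictCompl X Z' (2 * l)).hom := by
  intro Z W hZ hZi hZl hW hWi hWk s hs hZW
  -- proper intersection: nothing to move, `T := Z`
  by_cases hprop : ∀ t ∈ Z ∩ W, ((l + k : ℕ) : ℕ∞) ≤ coheight t
  · exact le_sup_of_le_left (le_iSup_of_le Z (le_iSup_of_le hZ (le_iSup_of_le hprop le_rfl)))
  have himp : ∃ t ∈ Z ∩ W, coheight t < ((l + k : ℕ) : ℕ∞) := by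
    push Not at hprop
    obtain ⟨t, ht, hlt⟩ := hprop
    exact ⟨t, ht, hlt⟩
  -- hence `1 ≤ l` (a point of `Z ∩ W ⊆ W` has codimension `≥ k`)
  have hl : 1 ≤ l := by
    obtain ⟨t, ht, hlt⟩ := himp
    by_contra h0
    have hl0 : l = 0 := by omega
    subst hl0
    have hk := hWk t ht.2
    rw [Nat.zero_add] at hlt
    exact absurd (lt_of_le_of_lt hk hlt) (lt_irrefl _)
  -- no point of `Z` has codimension `≤ l`: the kernel vanishes (semipurity)
  by_cases hpt : ∃ z ∈ Z, coheight z ≤ (l : ℕ∞)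
  swap
  · have h' : ∀ z ∈ Z, ((l + 1 : ℕ) : ℕ∞) ≤ coheight z := by
      intro z hz
      push Not at hpt
      have hlt := hpt z hz
      push_cast
      exact Order.add_one_le_of_lt hlt
    intro x hx
    have hinj := injective_restrictCompl_of_le_coheight hX hZ h' (i := 2 * l) (by omega)
    have h0 : x = 0 := hinj (by rw [LinearMap.mem_ker.1 hx, map_zero])
    rw [h0]
    exact Submodule.zero_mem _
  -- the main case: the generic projection cone
  obtain ⟨φ, hφ, Z', hZ'c, -, hZ'l, hpre, hZ'W, U, hZU, hU⟩ :=
    stub_genericProjection hX hl hZ hZi hZl hpt hW hWi hWk himp hZW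
  haveI := hφ
  have hP : IsSmoothProjective n (projectiveSpace n ℂ) := isSmoothProjective_projectiveSpace_holds ℂ n
  obtain ⟨hCc, hCi, hCl, hCl'⟩ := image_codim_of_isFinite hX hP φ hZ hZi hZl hpt
  obtain ⟨b, hb, hb0⟩ := stub_supportedClass_ne_zero hP hCc hCi hl hCl hCl'
  have hloc := exists_goodPoint hX hP φ hZ hZi hZU hU
  have hΘ := stub_coneTransport hX hP φ hl hZ hZi hZl hZ'c hpre hloc hb hb0
  refine hΘ.trans (sup_le (le_sup_of_le_left ?_) (le_sup_of_le_right ?_))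
  · rw [Submodule.span_le, Set.singleton_subset_iff]
    exact map_projectiveSpace_mem_iSup_ker_restrictCompl hX φ hW hWk b
  · exact le_iSup_of_le Z' (le_iSup_of_le hZ'c (le_iSup_of_le hZ'l (le_iSup_of_le hZ'W le_rfl)))

/-- **Voisin II Prop. 9.20 on the coniveau carrier — the tree's named fact
`Voisin2003_cupProduct_algebraicClasses` — from the cone step** (`cupProduct_mem_algebraicClasses_of_coneStep`,
everything downstream of `hstep` being proved in the tree). [cite: VoisinHodgeII2003, §9.2.4 Prop. 9.20] -/
theorem cupProduct_algebraicClasses : Voisin2003_cupProduct_algebraicClasses :=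
  fun _ _ hV _ _ _ _ hx hy ↦ cupProduct_mem_algebraicClasses_of_coneStep hV (coneStep hV) hx hy

/-- **(Δ) in full** — verbatim the support item `MotivatedLefschetzSplit.DiagonalPullbackAlgebraic`
(stmt-HodgeConjecture-17490) and the former stubs `stub_diagonalPullbackAlgebraic[_middleRange]` — from
the cone step (`diagonalPullbackAlgebraic_iff_cupProduct`, p137440). [cite: VoisinHodgeII2003, §9.2.4 Prop. 9.21 (i)] -/
theorem diagonalPullbackAlgebraic_of_stub :
    ∀ ⦃d : ℕ⦄ ⦃V : SchemeOver ℂ⦄, IsSmoothProjective d V → ∀ (p : ℕ)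
      ⦃c : complexBetti (V ⊗ V) (2 * p)⦄, c ∈ algebraicClasses (V ⊗ V) p →
        complexBetti.map (lift (𝟙 V) (𝟙 V)) (2 * p) c ∈ algebraicClasses V p :=
  diagonalPullbackAlgebraic_iff_cupProduct.2 cupProduct_algebraicClasses

/-- **The line concludes the crux BY NAME** from the registered stubs (sorries only inside `stub_*`):
the LANDED glue `hodgeBeyondAnchors_of_motivated_of_standardConjectureB_of_cupProduct :
HM → B → Prop. 9.20 → HodgeBeyondAnchors` (p137440) fed with (HM), (B) and the cone-step consequence
`cupProduct_algebraicClasses`. -/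
theorem HodgeBeyondAnchors_of : HodgeBeyondAnchors :=
  hodgeBeyondAnchors_of_motivated_of_standardConjectureB_of_cupProduct stub_hodgeClassesMotivated
    stub_lefschetzStandardB cupProduct_algebraicClasses

end Summit.HodgeConjecture.HodgeConjecture.Cruxes.HodgeBeyondAnchors.AndreMotivatedSplit

end
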